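import Summits.QuantumFields.YangMills.Theorems.UnitScaleTiltProp7CovariantDirichletComparison
import HarnessLib

/-!
# Route `UnitScaleTilt`, crux K1 «MinimiserStabilityRegPr» (stmt-QuantumFields-19200), EX row (5) `h3` (STOREY H), H2 pipeline (ii) — programme **H2-LOC**, brick **(C4a):
# THE COVARIANT CAMPANATO STEP** — one step of the Campanato iteration for the COVARIANT energy `φ(ρ) = Σ_{Q_ρ(z)}Σ_μ‖R(y,μ)u(y+e_μ) − u(y)‖²` of a solution of `L_R^κ u = D*_R g + src`
# on boxes where the unitary background is `δ`-close to `1`: `φ(ρ) ≤ (16A_d((ρ+1)∕(r+1))^d + (8A_d+4)·5dδ²N²)·φ(r+2) + (2r+5)^d·(…m², N²σ², dδ²M_u²…)`, `N = 2r+4` — the curved twin of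
# lit ✓`B4Eq19LatticeInteriorHolder.campanato_step`, with the SLACK term `ε = O(dδ²N²)` that ✓`Prop7CampanatoIterationEps` (px21 g16, C3a) was written for.

Cell `ym3-torus` (HUMAN RULING D-0037; rung R3 = SU(2) YM₃ on T³ — NOT d = 4, NOT infinite volume, NOT a mass gap, NOT Clay).  Width seat `ym3-torus-px19` (gen 16);
`--supports stmt-QuantumFields-19200 --as helper`; count-neutral; THEOREMS ONLY (0 `def`, 0 `sorry`, default heartbeats).  Inputs BY NAME: (C2b) ✓`Prop7CovariantDirichletComparison.covariant_dirichlet_comparison`,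
(C2a) ✓`Prop7LatticeVectorFlatTools.harmonic_decay_W`.  Operators written out as in (C1).

WHAT IS PROVED (ns `Summit.QuantumFields.YangMills.Theorems.Prop7CovariantCampanatoStep`; `W` finite-dimensional real inner-product space, `d ≥ 1`).
* §1 conversions between covariant and plain bond energies under `‖R(y,μ)x − x‖ ≤ δ‖x‖`: `sq_cov_flat_le`, `sum_flat_sq_le_cov` (factor `2`, error `2δ²ΣΣ‖u₊‖²`; the other direction is (C2b) ✓`cov_energy_le_flat`), `sum_shift_sq_le_of_bound`
  (`Σ_{Q_s}Σ_μ‖u(y+e_μ)‖² ≤ d(2s+1)^d M²` from `‖u‖ ≤ M` on `Q_{s+1}`), `flat_energy_add_le` (`‖(h+w)₊ − (h+w)‖²`-splitting, factor `2`).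
* §2 ★★★ `covariant_campanato_step` — `κ > 0`, `0 ≤ ρ ≤ r`, the equation on `Q_{r+1}(z)`, `‖u‖ ≤ M_u` on `Q_{r+3}(z)`, `‖g‖ ≤ m`, `‖src‖ ≤ σ`, `‖R − 1‖ ≤ δ` on `Q_{r+2}(z)`, `dδ²N² ≤ 1` ⟹
  `φ(ρ) ≤ (16A_d((ρ+1)∕(r+1))^d + (8A_d+4)(5dδ²N²))·φ(r+2) + (2r+5)^d((8A_d+4)·5·(4dm² + N²σ² + 5dδ²M_u²) + (16A_d+2)dδ²M_u²)`, `A_d = 2^d(1+56d)^d(8(d+1))^{d+1}`.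
HYP-SAT (★★OWNER RULING №42): (C2b)'s hypotheses verbatim; inhabited by `0`∕`R ≡ 1`.  HONEST SCOPE: [folklore] ([Giaquinta1984] III §2 Thm 2.2); the Morrey bound∕interior Hölder assembly is
(C4b); nothing of `hHlocV`, `hWsup`, H2, `h3`, norm_G, EX, 19200 or the rung is proved; the Yang–Mills mass gap is NOT proved.

References: T. Bałaban, CMP **99** (1985) 389–434 [Balaban1985BackgroundPropagators] (Thm 3.1 (3.43) p.398, (3.35) p.396); CMP **96** (1984) 223–250 [Balaban1984PropagatorsII] ((1.9) p.226);
M. Giaquinta, *Multiple integrals …* (1983) [Giaquinta1984] (Ch. III §2 Thm 2.2 pp.78–79).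
-/

set_option autoImplicit false

noncomputable section

open scoped BigOperators InnerProductSpace
open Finset

namespace Summit.QuantumFields.YangMills.Theorems.Prop7CovariantCampanatoStep

open Literature.MathematicalPhysics.QuantumFieldTheory.Balaban1983to89
open B4Eq19LatticeOperators (Zd unitVec box mem_box box_mono add_unitVec_mem_box card_box)
open Summit.QuantumFields.YangMills.Theorems.Prop7LatticeVectorFlatTools (harmonic_decay_W)
open Summit.QuantumFields.YangMills.Theorems.Prop7CovariantDirichletComparison (covariant_dirichlet_comparison cov_energy_le_flat)

variable {d : ℕ} {W : Type*} [NormedAddCommGroup W] [InnerProductSpace ℝ W]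

/-! ## §1 Covariant ↔ plain bond energies -/

/-- Bond by bond: `‖Ru₁ − u₀‖² ≤ 2‖u₁ − u₀‖² + 2δ²‖u₁‖²` and `‖u₁ − u₀‖² ≤ 2‖Ru₁ − u₀‖² + 2δ²‖u₁‖²` when `‖Ru₁ − u₁‖ ≤ δ‖u₁‖`.
[folklore] [cite: Balaban1985BackgroundPropagators, (3.35) p.396] -/
theorem sq_cov_flat_le (R : W ≃ₗᵢ[ℝ] W) (u₀ u₁ : W) {δ : ℝ} (hR : ‖R u₁ - u₁‖ ≤ δ * ‖u₁‖) :
    ‖R u₁ - u₀‖ ^ 2 ≤ 2 * ‖u₁ - u₀‖ ^ 2 + 2 * (δ ^ 2 * ‖u₁‖ ^ 2) ∧ ‖u₁ - u₀‖ ^ 2 ≤ 2 * ‖R u₁ - u₀‖ ^ 2 + 2 * (δ ^ 2 * ‖u₁‖ ^ 2) := by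
  have h0 : 0 ≤ δ * ‖u₁‖ := (norm_nonneg _).trans hR
  have e1 : R u₁ - u₀ = (u₁ - u₀) + (R u₁ - u₁) := by abel
  have e2 : u₁ - u₀ = (R u₁ - u₀) - (R u₁ - u₁) := by abel
  have h1 : ‖R u₁ - u₀‖ ≤ ‖u₁ - u₀‖ + δ * ‖u₁‖ := by rw [e1]; exact (norm_add_le _ _).trans (add_le_add le_rfl hR)
  have h2 : ‖u₁ - u₀‖ ≤ ‖R u₁ - u₀‖ + δ * ‖u₁‖ := by
    conv_lhs => rw [e2]
    exact (norm_sub_le _ _).trans (add_le_add le_rfl hR)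
  have s1 := two_mul_le_add_sq ‖u₁ - u₀‖ (δ * ‖u₁‖)
  have s2 := two_mul_le_add_sq ‖R u₁ - u₀‖ (δ * ‖u₁‖)
  rw [mul_pow] at s1 s2
  constructor
  · calc ‖R u₁ - u₀‖ ^ 2 ≤ (‖u₁ - u₀‖ + δ * ‖u₁‖) ^ 2 := pow_le_pow_left₀ (norm_nonneg _) h1 2
      _ = ‖u₁ - u₀‖ ^ 2 + 2 * ‖u₁ - u₀‖ * (δ * ‖u₁‖) + δ ^ 2 * ‖u₁‖ ^ 2 := by ring
      _ ≤ _ := by linarith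
  · calc ‖u₁ - u₀‖ ^ 2 ≤ (‖R u₁ - u₀‖ + δ * ‖u₁‖) ^ 2 := pow_le_pow_left₀ (norm_nonneg _) h2 2
      _ = ‖R u₁ - u₀‖ ^ 2 + 2 * ‖R u₁ - u₀‖ * (δ * ‖u₁‖) + δ ^ 2 * ‖u₁‖ ^ 2 := by ring
      _ ≤ _ := by linarith

/-- Summed: `Σ_QΣ_μ‖u₊ − u‖² ≤ 2Σ_QΣ_μ‖Ru₊ − u‖² + 2δ²Σ_QΣ_μ‖u₊‖²`. [folklore] [cite: Balaban1985BackgroundPropagators, (3.35) p.396] -/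
theorem sum_flat_sq_le_cov (R : Zd d → Fin d → (W ≃ₗᵢ[ℝ] W)) (u : Zd d → W) (Q : Finset (Zd d)) {δ : ℝ}
    (hR : ∀ y ∈ Q, ∀ (μ : Fin d) (x : W), ‖R y μ x - x‖ ≤ δ * ‖x‖) :
    ∑ y ∈ Q, ∑ μ, ‖u (y + unitVec μ) - u y‖ ^ 2 ≤ 2 * ∑ y ∈ Q, ∑ μ, ‖R y μ (u (y + unitVec μ)) - u y‖ ^ 2 + 2 * (δ ^ 2 * ∑ y ∈ Q, ∑ μ, ‖u (y + unitVec μ)‖ ^ 2) := by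
  rw [Finset.mul_sum, Finset.mul_sum, Finset.mul_sum, ← Finset.sum_add_distrib]
  refine Finset.sum_le_sum fun y hy => ?_
  rw [Finset.mul_sum, Finset.mul_sum, Finset.mul_sum, ← Finset.sum_add_distrib]
  exact Finset.sum_le_sum fun μ _ => (sq_cov_flat_le (R y μ) (u y) (u (y + unitVec μ)) (hR y hy μ _)).2

omit [InnerProductSpace ℝ W] in
/-- Shifted mass on a box: `‖u‖ ≤ M` on `Q_{s+1}(z)` ⟹ `Σ_{Q_s(z)}Σ_μ‖u(y+e_μ)‖² ≤ d(2s+1)^d M²` (`s ≥ 0`). [folklore] [cite: Giaquinta1984, Ch. III §1 p.64] -/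
theorem sum_shift_sq_le_of_bound (u : Zd d → W) (z : Zd d) {s : ℤ} (hs : 0 ≤ s) {M : ℝ} (hu : ∀ y ∈ box z (s + 1), ‖u y‖ ≤ M) :
    ∑ y ∈ box z s, ∑ μ, ‖u (y + unitVec μ)‖ ^ 2 ≤ d * ((2 * s + 1 : ℤ) : ℝ) ^ d * M ^ 2 := by
  have h1 : ∑ y ∈ box z s, ∑ μ, ‖u (y + unitVec μ)‖ ^ 2 ≤ ∑ _y ∈ box z s, ∑ _μ : Fin d, M ^ 2 :=
    Finset.sum_le_sum fun y hy => Finset.sum_le_sum fun μ _ => pow_le_pow_left₀ (norm_nonneg _) (hu _ (add_unitVec_mem_box hy μ)) 2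
  simp only [Finset.sum_const, Finset.card_univ, Fintype.card_fin, nsmul_eq_mul] at h1
  rw [card_box z hs] at h1
  linarith

omit [InnerProductSpace ℝ W] in
/-- Plain energy of a sum: `ΣΣ‖(h+w)₊ − (h+w)‖² ≤ 2ΣΣ‖h₊ − h‖² + 2ΣΣ‖w₊ − w‖²`, and of a difference likewise. [folklore] [cite: Giaquinta1984, Ch. III §2 p.79] -/
theorem flat_energy_add_le (h w : Zd d → W) (Q : Finset (Zd d)) :
    ∑ y ∈ Q, ∑ μ, ‖(h (y + unitVec μ) + w (y + unitVec μ)) - (h y + w y)‖ ^ 2 ≤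
      2 * ∑ y ∈ Q, ∑ μ, ‖h (y + unitVec μ) - h y‖ ^ 2 + 2 * ∑ y ∈ Q, ∑ μ, ‖w (y + unitVec μ) - w y‖ ^ 2 ∧
    ∑ y ∈ Q, ∑ μ, ‖(h (y + unitVec μ) - w (y + unitVec μ)) - (h y - w y)‖ ^ 2 ≤
      2 * ∑ y ∈ Q, ∑ μ, ‖h (y + unitVec μ) - h y‖ ^ 2 + 2 * ∑ y ∈ Q, ∑ μ, ‖w (y + unitVec μ) - w y‖ ^ 2 := by
  constructor
  all_goals
    rw [Finset.mul_sum, Finset.mul_sum, ← Finset.sum_add_distrib]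
    refine Finset.sum_le_sum fun y _ => ?_
    rw [Finset.mul_sum, Finset.mul_sum, ← Finset.sum_add_distrib]
    refine Finset.sum_le_sum fun μ _ => ?_
  · have e : (h (y + unitVec μ) + w (y + unitVec μ)) - (h y + w y) = (h (y + unitVec μ) - h y) + (w (y + unitVec μ) - w y) := by abel
    rw [e]
    have h1 := norm_add_le (h (y + unitVec μ) - h y) (w (y + unitVec μ) - w y)
    have h2 := two_mul_le_add_sq ‖h (y + unitVec μ) - h y‖ ‖w (y + unitVec μ) - w y‖
    nlinarith [norm_nonneg ((h (y + unitVec μ) - h y) + (w (y + unitVec μ) - w y))]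
  · have e : (h (y + unitVec μ) - w (y + unitVec μ)) - (h y - w y) = (h (y + unitVec μ) - h y) - (w (y + unitVec μ) - w y) := by abel
    rw [e]
    have h1 := norm_sub_le (h (y + unitVec μ) - h y) (w (y + unitVec μ) - w y)
    have h2 := two_mul_le_add_sq ‖h (y + unitVec μ) - h y‖ ‖w (y + unitVec μ) - w y‖
    nlinarith [norm_nonneg ((h (y + unitVec μ) - h y) - (w (y + unitVec μ) - w y))]

/-! ## §2 ★★★ The covariant Campanato step -/

/-- ★★★ **THE COVARIANT CAMPANATO STEP.**  `d ≥ 1`, `κ > 0`, integers `0 ≤ ρ ≤ r`, `N = 2r+4`, `A_d = 2^d(1+56d)^d(8(d+1))^{d+1}`; `L_R^κ u = D*_R g + src` on `Q_{r+1}(z)`;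
`‖u‖ ≤ M_u` on `Q_{r+3}(z)`; `‖g(y,μ)‖ ≤ m`, `‖src(y)‖ ≤ σ`, `‖R(y,μ)x − x‖ ≤ δ‖x‖` for `y ∈ Q_{r+2}(z)`; `dδ²N² ≤ 1`.  Then, with `φ(s) := Σ_{Q_s(z)}Σ_μ‖R(y,μ)u(y+e_μ) − u(y)‖²`,
`φ(ρ) ≤ (16A_d((ρ+1)∕(r+1))^d + (8A_d + 4)(5dδ²N²))·φ(r+2) + (2r+5)^d·((8A_d + 4)·5·(4dm² + N²σ² + 5dδ²M_u²) + (16A_d + 2)dδ²M_u²)`.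
PROOF: `u = h + w` by (C2b); `φ(ρ) ≤ 2F_u(ρ) + 2δ²S_ρ`, `F_u ≤ 2F_h + 2F_w`, `F_h(ρ) ≤ A_d q F_h(r)` ((C2a) ✓`harmonic_decay_W`), `F_h(r) ≤ 2F_u(r) + 2F_w(r)`, `F_u(r) ≤ 2φ(r) + 2δ²S_r`,
`F_w ≤ E ≤ 5dδ²N²φ(r+2) + 5V(…)`, `φ(r) ≤ φ(r+2)`, `S ≤ dVM_u²`. [folklore] [cite: Giaquinta1984, Ch. III §2 Thm 2.2 pp.78–79; Balaban1985BackgroundPropagators, Thm 3.1 (3.43) p.398] -/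
theorem covariant_campanato_step [FiniteDimensional ℝ W] (hd : 1 ≤ d) (R : Zd d → Fin d → (W ≃ₗᵢ[ℝ] W)) {κ : ℝ} (hκ : 0 < κ)
    (u : Zd d → W) (g : Zd d → Fin d → W) (src : Zd d → W) (z : Zd d) {ρ r : ℤ} (hρ : 0 ≤ ρ) (hρr : ρ ≤ r)
    {Mu m σ δ : ℝ} (hMu : 0 ≤ Mu) (hm : 0 ≤ m) (hσ : 0 ≤ σ) (hδ : 0 ≤ δ)
    (hEq : ∀ y ∈ box z (r + 1),
      (∑ μ, ((2 : ℝ) • u y - R y μ (u (y + unitVec μ)) - (R (y - unitVec μ) μ).symm (u (y - unitVec μ)))) + κ • u y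
        = (∑ μ, ((R (y - unitVec μ) μ).symm (g (y - unitVec μ) μ) - g y μ)) + src y)
    (hu : ∀ y ∈ box z (r + 3), ‖u y‖ ≤ Mu)
    (hg : ∀ y ∈ box z (r + 2), ∀ μ, ‖g y μ‖ ≤ m)
    (hs : ∀ y ∈ box z (r + 2), ‖src y‖ ≤ σ)
    (hR : ∀ y ∈ box z (r + 2), ∀ (μ : Fin d) (x : W), ‖R y μ x - x‖ ≤ δ * ‖x‖)
    (hsmall : (d : ℝ) * δ ^ 2 * ((2 * r + 4 : ℤ) : ℝ) ^ 2 ≤ 1) :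
    ∑ y ∈ box z ρ, ∑ μ, ‖R y μ (u (y + unitVec μ)) - u y‖ ^ 2 ≤
      (16 * ((2 : ℝ) ^ d * (1 + 56 * d) ^ d * (8 * ((d : ℝ) + 1)) ^ (d + 1)) * (((ρ : ℝ) + 1) / ((r : ℝ) + 1)) ^ d
          + (8 * ((2 : ℝ) ^ d * (1 + 56 * d) ^ d * (8 * ((d : ℝ) + 1)) ^ (d + 1)) + 4) * (5 * d * δ ^ 2 * ((2 * r + 4 : ℤ) : ℝ) ^ 2))
        * ∑ y ∈ box z (r + 2), ∑ μ, ‖R y μ (u (y + unitVec μ)) - u y‖ ^ 2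
      + ((2 * (r + 2) + 1 : ℤ) : ℝ) ^ d *
        ((8 * ((2 : ℝ) ^ d * (1 + 56 * d) ^ d * (8 * ((d : ℝ) + 1)) ^ (d + 1)) + 4) * (5 * (4 * d * m ^ 2 + ((2 * r + 4 : ℤ) : ℝ) ^ 2 * σ ^ 2 + 5 * d * δ ^ 2 * Mu ^ 2))
          + (16 * ((2 : ℝ) ^ d * (1 + 56 * d) ^ d * (8 * ((d : ℝ) + 1)) ^ (d + 1)) + 2) * (d * δ ^ 2 * Mu ^ 2)) := by
  classical
  set A : ℝ := (2 : ℝ) ^ d * (1 + 56 * d) ^ d * (8 * ((d : ℝ) + 1)) ^ (d + 1) with hA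
  set N : ℝ := ((2 * r + 4 : ℤ) : ℝ) with hNdef
  set V : ℝ := ((2 * (r + 2) + 1 : ℤ) : ℝ) ^ d with hVdef
  have hA0 : 0 ≤ A := by positivity
  have hr : 0 ≤ r := hρ.trans hρr
  have hd0 : (0 : ℝ) ≤ d := Nat.cast_nonneg d
  have hq0 : 0 ≤ ((ρ : ℝ) + 1) / ((r : ℝ) + 1) := by
    have : (0:ℝ) ≤ ρ := by exact_mod_cast hρ
    have : (0:ℝ) ≤ r := by exact_mod_cast hr
    positivity
  have hq1 : ((ρ : ℝ) + 1) / ((r : ℝ) + 1) ≤ 1 := by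
    have : (ρ : ℝ) ≤ r := by exact_mod_cast hρr
    have : (0:ℝ) ≤ r := by exact_mod_cast hr
    rw [div_le_one (by linarith)]; linarith
  set q : ℝ := (((ρ : ℝ) + 1) / ((r : ℝ) + 1)) ^ d with hqdef
  have hqq0 : 0 ≤ q := pow_nonneg hq0 _
  have hqq1 : q ≤ 1 := pow_le_one₀ hq0 hq1
  have hV0 : 0 ≤ V := by rw [hVdef]; exact pow_nonneg (by exact_mod_cast (by linarith : (0 : ℤ) ≤ 2 * (r + 2) + 1)) _
  -- the comparison on `Q_{r+1}`
  obtain ⟨h, w, hsum, hw0, hh, hwE⟩ := covariant_dirichlet_comparison hd R hκ u g src z hr hMu hm hσ hδ hEq hu hg hs hR hsmall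
  rw [← hNdef, ← hVdef] at hwE
  -- notation for energies
  set φρ : ℝ := ∑ y ∈ box z ρ, ∑ μ, ‖R y μ (u (y + unitVec μ)) - u y‖ ^ 2 with hφρ
  set φr : ℝ := ∑ y ∈ box z r, ∑ μ, ‖R y μ (u (y + unitVec μ)) - u y‖ ^ 2 with hφr
  set φr2 : ℝ := ∑ y ∈ box z (r + 2), ∑ μ, ‖R y μ (u (y + unitVec μ)) - u y‖ ^ 2 with hφr2
  set Fuρ : ℝ := ∑ y ∈ box z ρ, ∑ μ, ‖u (y + unitVec μ) - u y‖ ^ 2 with hFuρ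
  set Fur : ℝ := ∑ y ∈ box z r, ∑ μ, ‖u (y + unitVec μ) - u y‖ ^ 2 with hFur
  set Fhρ : ℝ := ∑ y ∈ box z ρ, ∑ μ, ‖h (y + unitVec μ) - h y‖ ^ 2 with hFhρ
  set Fhr : ℝ := ∑ y ∈ box z r, ∑ μ, ‖h (y + unitVec μ) - h y‖ ^ 2 with hFhr
  set Fwρ : ℝ := ∑ y ∈ box z ρ, ∑ μ, ‖w (y + unitVec μ) - w y‖ ^ 2 with hFwρ
  set Fwr : ℝ := ∑ y ∈ box z r, ∑ μ, ‖w (y + unitVec μ) - w y‖ ^ 2 with hFwr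
  set E : ℝ := ∑ y ∈ box z (r + 2), ∑ μ, ‖w (y + unitVec μ) - w y‖ ^ 2 with hE
  set Sρ : ℝ := ∑ y ∈ box z ρ, ∑ μ, ‖u (y + unitVec μ)‖ ^ 2 with hSρ
  set Sr : ℝ := ∑ y ∈ box z r, ∑ μ, ‖u (y + unitVec μ)‖ ^ 2 with hSr
  have nn2 : ∀ (Q : Finset (Zd d)) (f : Zd d → Fin d → W), 0 ≤ ∑ y ∈ Q, ∑ μ, ‖f y μ‖ ^ 2 :=
    fun Q f => Finset.sum_nonneg fun _ _ => Finset.sum_nonneg fun _ _ => sq_nonneg _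
  have hE0 : 0 ≤ E := nn2 _ (fun y μ => w (y + unitVec μ) - w y)
  have hφr20 : 0 ≤ φr2 := nn2 _ (fun y μ => R y μ (u (y + unitVec μ)) - u y)
  -- monotonicity in the box
  have hsubρ : box z ρ ⊆ box z (r + 2) := box_mono z (by linarith)
  have hsubr : box z r ⊆ box z (r + 2) := box_mono z (by linarith)
  have hφr_le : φr ≤ φr2 := Finset.sum_le_sum_of_subset_of_nonneg hsubr fun _ _ _ => Finset.sum_nonneg fun _ _ => sq_nonneg _
  have hFwρ_le : Fwρ ≤ E := Finset.sum_le_sum_of_subset_of_nonneg hsubρ fun _ _ _ => Finset.sum_nonneg fun _ _ => sq_nonneg _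
  have hFwr_le : Fwr ≤ E := Finset.sum_le_sum_of_subset_of_nonneg hsubr fun _ _ _ => Finset.sum_nonneg fun _ _ => sq_nonneg _
  -- the `δ`-rows on the smaller boxes
  have hRρ : ∀ y ∈ box z ρ, ∀ (μ : Fin d) (x : W), ‖R y μ x - x‖ ≤ δ * ‖x‖ := fun y hy => hR y (hsubρ hy)
  have hRr : ∀ y ∈ box z r, ∀ (μ : Fin d) (x : W), ‖R y μ x - x‖ ≤ δ * ‖x‖ := fun y hy => hR y (hsubr hy)
  -- shifted masses
  have hSρ_le : Sρ ≤ d * V * Mu ^ 2 := by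
    have h1 := sum_shift_sq_le_of_bound u z hρ (M := Mu) (fun y hy => hu y (box_mono z (by linarith) hy))
    have h2 : ((2 * ρ + 1 : ℤ) : ℝ) ^ d ≤ V := by
      rw [hVdef]; exact pow_le_pow_left₀ (by exact_mod_cast (by linarith : (0:ℤ) ≤ 2 * ρ + 1)) (by exact_mod_cast (by linarith : 2 * ρ + 1 ≤ 2 * (r + 2) + 1)) _
    calc Sρ ≤ d * ((2 * ρ + 1 : ℤ) : ℝ) ^ d * Mu ^ 2 := h1
      _ ≤ d * V * Mu ^ 2 := by gcongr
  have hSr_le : Sr ≤ d * V * Mu ^ 2 := by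
    have h1 := sum_shift_sq_le_of_bound u z hr (M := Mu) (fun y hy => hu y (box_mono z (by linarith) hy))
    have h2 : ((2 * r + 1 : ℤ) : ℝ) ^ d ≤ V := by
      rw [hVdef]; exact pow_le_pow_left₀ (by exact_mod_cast (by linarith : (0:ℤ) ≤ 2 * r + 1)) (by exact_mod_cast (by linarith : 2 * r + 1 ≤ 2 * (r + 2) + 1)) _
    calc Sr ≤ d * ((2 * r + 1 : ℤ) : ℝ) ^ d * Mu ^ 2 := h1
      _ ≤ d * V * Mu ^ 2 := by gcongr
  -- conversions
  have c1 : φρ ≤ 2 * Fuρ + 2 * (δ ^ 2 * Sρ) := cov_energy_le_flat R u _ hRρ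
  have c2 : Fur ≤ 2 * φr + 2 * (δ ^ 2 * Sr) := sum_flat_sq_le_cov R u _ hRr
  -- `u = h + w` splits the plain energies
  have hu_eq : u = fun y => h y + w y := funext hsum
  have hh_eq : h = fun y => u y - w y := by funext y; rw [hsum y]; abel
  have c3 : Fuρ ≤ 2 * Fhρ + 2 * Fwρ := by rw [hFuρ, hu_eq]; exact (flat_energy_add_le h w _).1
  have c4 : Fhr ≤ 2 * Fur + 2 * Fwr := by rw [hFhr, hh_eq]; exact (flat_energy_add_le u w _).2
  -- harmonic decay for `h`
  set Aq : ℝ := A * q with hAq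
  have hAq0 : 0 ≤ Aq := mul_nonneg hA0 hqq0
  have hAq1 : Aq ≤ A := mul_le_of_le_one_right hA0 hqq1
  have c5 : Fhρ ≤ Aq * Fhr := by
    have := harmonic_decay_W hκ.le hρ hρr h hh
    rw [← hA] at this; rw [hAq]; exact this
  -- assemble (linear bookkeeping only)
  have step1 : φρ ≤ 4 * (Aq * Fhr) + 4 * E + 2 * (δ ^ 2 * Sρ) := by linarith [c1, c3, c5, hFwρ_le]
  have step2 : Fhr ≤ 4 * φr2 + 4 * (δ ^ 2 * Sr) + 2 * E := by linarith [c4, c2, hFwr_le, hφr_le]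
  have h3 : Aq * Fhr ≤ Aq * (4 * φr2 + 4 * (δ ^ 2 * Sr) + 2 * E) := mul_le_mul_of_nonneg_left step2 hAq0
  have e3 : Aq * (4 * φr2 + 4 * (δ ^ 2 * Sr) + 2 * E) = 4 * (Aq * φr2) + 4 * (Aq * (δ ^ 2 * Sr)) + 2 * (Aq * E) := by ring
  have step3 : φρ ≤ 16 * (Aq * φr2) + 8 * (Aq * E) + 4 * E + 16 * (Aq * (δ ^ 2 * Sr)) + 2 * (δ ^ 2 * Sρ) := by linarith [step1, h3, e3]
  have hδS1 : δ ^ 2 * Sr ≤ d * V * (δ ^ 2 * Mu ^ 2) := by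
    have := mul_le_mul_of_nonneg_left hSr_le (sq_nonneg δ); linarith [this, show δ ^ 2 * (d * V * Mu ^ 2) = d * V * (δ ^ 2 * Mu ^ 2) by ring]
  have hδS2 : δ ^ 2 * Sρ ≤ d * V * (δ ^ 2 * Mu ^ 2) := by
    have := mul_le_mul_of_nonneg_left hSρ_le (sq_nonneg δ); linarith [this, show δ ^ 2 * (d * V * Mu ^ 2) = d * V * (δ ^ 2 * Mu ^ 2) by ring]
  have hδSr0 : 0 ≤ δ ^ 2 * Sr := mul_nonneg (sq_nonneg δ) (nn2 (box z r) (fun y μ => u (y + unitVec μ)))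
  have b1 : Aq * E ≤ A * E := mul_le_mul_of_nonneg_right hAq1 hE0
  have b2 : Aq * (δ ^ 2 * Sr) ≤ A * (d * V * (δ ^ 2 * Mu ^ 2)) := mul_le_mul hAq1 hδS1 hδSr0 hA0
  have step4 : φρ ≤ 16 * (Aq * φr2) + (8 * A + 4) * E + (16 * A + 2) * (d * V * (δ ^ 2 * Mu ^ 2)) := by linarith [step3, b1, b2, hδS2]
  -- plug the comparison bound for `E`
  have step5 : (8 * A + 4) * E ≤ (8 * A + 4) * (5 * d * δ ^ 2 * N ^ 2 * φr2 + 5 * V * (4 * d * m ^ 2 + N ^ 2 * σ ^ 2 + 5 * d * δ ^ 2 * Mu ^ 2)) :=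
    mul_le_mul_of_nonneg_left hwE (by positivity)
  calc φρ ≤ 16 * (Aq * φr2) + (8 * A + 4) * (5 * d * δ ^ 2 * N ^ 2 * φr2 + 5 * V * (4 * d * m ^ 2 + N ^ 2 * σ ^ 2 + 5 * d * δ ^ 2 * Mu ^ 2))
        + (16 * A + 2) * (d * V * (δ ^ 2 * Mu ^ 2)) := by linarith [step4, step5]
    _ = (16 * A * q + (8 * A + 4) * (5 * d * δ ^ 2 * N ^ 2)) * φr2
        + V * ((8 * A + 4) * (5 * (4 * d * m ^ 2 + N ^ 2 * σ ^ 2 + 5 * d * δ ^ 2 * Mu ^ 2)) + (16 * A + 2) * (d * δ ^ 2 * Mu ^ 2)) := by rw [hAq]; ring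

end Summit.QuantumFields.YangMills.Theorems.Prop7CovariantCampanatoStep

end
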